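import Summits.ResolutionOfSingularities.ResolutionOfSingularities.Theorems.PurityCutGrand
import Literature.AlgebraicGeometry.Resolution.HironakaTauScheme
import Literature.AlgebraicGeometry.Resolution.BlowupSequences
import Literature.AlgebraicGeometry.Resolution.MarkedIdeals
import Literature.AlgebraicGeometry.Resolution.StalkSpecializesLocalization
import Mathlib.Algebra.CharP.Defs
import Mathlib.Algebra.CharP.Lemmas
import Mathlib.Data.Nat.Multiplicity
import HarnessLib

/-!
# SplitCutKernels — decomp-res node «SplitCut» (lens-2 g17), file 1/2 of `SplitCutKernels`

[WRITER NOTE (decomp-res writer g10).  Content VERBATIM from the decomp-res lens-2 g17 node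
`HOME/decomp-res-lens-2/g17/SplitCut.lean` (pin 301f7a3a, 2 469 l; parts in `g17/parts/`, SHA256SUMS verified by the critic;
HOME = run/shared/lean/pub/decomp-res; CRITIC-LEDGER row 146 (claim DECIDED-MOD-PORT(M+) +1 under row 140's window
(ii)); landing orders INBOX :365: land AFTER the PurityCut
chain with ALL restated sections (§R16, §R, §G, §P, §H — l. 244–2018: the lens's verbatim-in-body copies of lens-2
g14 `PinchCut`, g15 `JetCut` rev 5 and g16 `PurityCut` rev 1)
DELETED and the landed modules imported instead (namespaces `…Theorems.PinchCut`, `…Theorems.JetCut` (+ `Vast`),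
`…Theorems.PurityCut` (+ `Leaf`, `Grand`) opened; same short
names, byte-identical bodies — never two copies).  Namespace `…Theorems.SplitCut` (the lens's `Theses.SplitCut` is
gate-reserved), sub-namespace `Split` as in the lens;
file split only (tree files ≤ 400 lines): sections, variables and every declaration exactly as in the lens; the
node's global dupNamespace-linter line dropped.  Node files,
in import order: `SplitCutKernels` (§S1) · `SplitCutClasses` (§S2 + the cone-free head of §T) · `SplitCutCells`
(§T2–§T4 cone-free: the aside home) · the wiring
`MaxContactCutSplitCut` (§T BY NAME on the host route, in the Theses cone).  All `--supports
stmt-ResolutionOfSingularities-29273` (`MaxContactCut.RungOne`); nothing closes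
29273 — decided halves carry their engines as hypotheses; exactly ONE located-residual aside on the lens-2 column
(`Split.SplitSpecialRung`, home `SplitCutCells`) SUPERSEDES
g16's `Grand.GrandSpecialRung`, re-located EXACTLY modulo the split decided half
(`grandSpecialRung_iff_splitSpecialRung`).  The lens header is kept verbatim below.]

# SplitCut — LAW (S): SPLIT CONES (critic window (ii) PROPER — «an initial form with a cancelling edge and NO vertex
monomial at all; binary towers»): the cone `Σ_j G_j z^{n-j} U^j`, typed by its binary form along the curve NOT being the `n`-th
power of a linear form (a MIDDLE coefficient `u·ϖ^e` of `ϖ`-order `e ≤ j`; no parity clause), replaces the Frobenius binomial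
`zⁿ + βUⁿ` of every ladder; ENGINE `SplitConeExit` EXACT-ON-PAPER with a NEW exit mechanism (over the core each stage leaves a
whole FIBRE LINE of order-`n` points of `τ = 2` standing; no side clause, no stray clause); the located residual
`Grand.GrandSpecialRung` of g16 RE-LOCATED EXACTLY (0 sorry) as `Split.SplitSpecialRung`, losing the census-confirmed bed
`R1 = z² + v·z·(u₁+u₂) + u₁⁵ + u₂⁷ /𝔽₂` (cone `z(z + vU)`: no vertex monomial) and `R3 = z³ − v²z(u₁+u₂)² + u₁⁷ + u₂⁸ /𝔽₃`
(cone `z(z − vU)(z + vU)`) (decomp-res lens-2 «structural dichotomy (special vs generic)», g17)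

ROOT DECOMPOSITION CELL `decomp-res`, RESIDUAL MODE (D-0179), generation 17.  TARGET (tree item, BY NAME):
`MaxContactCut.RungOne` (stmt-ResolutionOfSingularities-29273, `E 2 → E 1`: the dimension-four core of the order axis in
SEQUENCE form); LOCATED RESIDUAL CUT: g16's `Grand.GrandSpecialRung` (class `IsGrandSpecialPt`), restated verbatim-in-body here
(§R16) because g14/g15/g16 live as HOME files only and a HOME file cannot be imported by a farm check (every restated body is
byte-identical to the pinned source `g16/parts/PurityCut-rev1-c1c78f8a.lean`; index in NODE-g17.md §R).  This file IMPORTS the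
tree modules of g9–g13 (nothing restated from them).  New content: §S (the split-cone law and engine, ring kernels, the
inhabitant's complete ring-level shape certificate), §T (the split cut).  0 `sorry`, 0 new axioms; `lean check` rc 0.

## §1  CRITIC WINDOW g17 (CRITIC-LEDGER row 140 + COSTUME-CENSUS v17 N103a) — what is priced and how this file answers

Priced 0: any principal-tail LADDER continuation (the ladder family on 29273 is CLOSED: (L)(L′)(D)(D⁺) and their stray/side
refinements), re-indexing, composite «curve package then point engine» classes.  Priced +1: (ii) CANCELLING EDGE FORMS / binary
towers PROPER decided by a LAW with EXACT re-location of `Grand.GrandSpecialRung` and a booked inhabitant; or (iii) a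
non-principal law; or (iv) a Sing/Tangle/Iso engine; MAP = port-L.
THIS FILE takes (ii).  The law (S) is NOT a ladder: (1) the CONE changes — every ladder cone of the lineage is the Frobenius
binomial `zⁿ + βUⁿ` (one edge `z–U` whose form `(z + β^{1/n}U)ⁿ` CANCELS to a single `n`-th power under the guard: the
«cancelling edge»); the split cone `z(z + vU)`, `z(z − vU)(z + vU)`, `(z² + vzU)²`, … has a binary form over `A =
𝒪_{C,y}` that is NEVER
`λ·ℓⁿ` (a middle coefficient survives — separable products and inseparable squares alike: NO parity / separability clause), and
it has NO VERTEX MONOMIAL `Uⁿ` at all (`VertexTame`); (2) the TAIL clause is the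
bare weight ideal `Wt(c; n, k, nk+1)` — NO `SideClean`, NO `StrayClean`, no last-stage fibre polynomial; (3) the
EXIT MECHANISM is
new: the ladders exit by ORDER everywhere, (S) exits over the core by `τ = 2` along positive-dimensional fibre lines
that are left
standing (`PackageExitsOver` asks exactly `2 ≤ tauAt` at surviving order-`n` points); (4) the inhabitant `R1` is OUTSIDE every
class of the lineage BY AN INVARIANT (§3 LEMMA Q_S: the polar form of the `𝔭`-initial quadratic form), not by a threshold count.
PRICING CRITERIA (crit-1 → lens-2, INBOX 2026-08-30T21:15:36Z) and where each is met: (1) the decided cell is typed by the CONE,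
not by an exit clause — `IsSplitConeAt` asks a presentation whose `𝔭`-initial form is the binary form `B = Σ G_j X₀^{n-j} X₁^j`
over `A = 𝒪_{C,y}` with (`MiddleCoeff`) a middle coefficient of `ϖ`-order `e ≤ j` — at unit points and over `κ(η)` literally
«`B̄` is not the `n`-th power of a linear form», at the core its `ϖ`-adic sharpening (the middle term REACHES the
order-`n` initial
form on the fibre line: weight `e + n − j ≤ n`) — and (`VertexTame`) no unit vertex without a middle unit; NO parity clause (the
inseparable square S4-j2 is a member); the tail letters `εW^k + h`, `h ∈ Wt`, `n ≤ k`, `n ∤ k` are the lineage's common NORMAL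
FORM of `f − cone` ((L)…(G) verbatim) and `⌊k/n⌋` appears only in the CONCLUSION (`ladder_depth`); (2) the law decides EVERY
point of its cell — exit in the exact sense of `PackageExitsOver` (§2) — MOD the existing port `CurvePackagePort`
(M+) exactly as
rows 133/140 (`Split.splitGenericRung_of_engines`); (3) `Split.grandSpecialRung_iff_splitSpecialRung (hG) :
Grand.GrandSpecialRung
↔ Split.SplitSpecialRung`, EXACT under the decided half, as row 140; (4) `R1 ∈ IsGrandSpecialPt` is certified for EVERY frame by
§3 LEMMA Q_S (membership by invariant), `R1 ∈ IsSplitConeCurvePt` by `splitConeShape_R1` (KERNEL, every clause) + Top `= C`,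
entry evidence census T-split-cone 12/12 (booked by census-1).

## §2  THE LAW (S) AND ITS PROOF ON PAPER (ENGINE `SplitConeExit`; every chart step is a KERNEL below or a named
port ingredient)

DATA at a closed point `y` of `C = closure {η}` (`IsSplitConeAt`): `R = 𝒪_{Y,y}` regular of dimension 4, regular parameters
`c = (z, U, W)` generating the curve prime `𝔭`, a fourth parameter (`(c, v) = 𝔪`), `I_y = (f)`,
`f = Σ_{j=0}^{n} G_j z^{n-j} U^j + ε W^k + h` with `G_0 = 1`, `ε` a unit, `h ∈ Wt(c; n, k, nk+1)`, `n ≤ k`, `n ∤ k`, the guard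
`C(n,i) ∈ 𝔪` (`0<i<n`), the middle-coefficient clause `G_{j*} = u ϖ^e` (`0 < j* < n`, `u` unit, `e ≤ j*`, `ϖ` with
`(c, ϖ) = 𝔪` or
`ϖ` a unit) and the vertex clause (`G_n ∈ 𝔪` unless some middle `G_j` is a unit).  Put `N = ⌊k/n⌋`, `K = k mod n ∈ [1, n−1]`
(`ladder_depth`).  Let `B̄ = X₀ⁿ + Σ_{j≥1} Ḡ_j X₀^{n-j} X₁^j ∈ κ(y)[X₀, X₁]` be the RESIDUE BINARY FORM.  By the two clauses
exactly one of: (A) `B̄` has a non-zero MIDDLE coefficient; (K) `Ḡ_j = 0` for all `j ≥ 1` (the CORE type; then `ϖ` is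
transversal and `1 ≤ e ≤ j*`).  [(B) «middle zero, vertex unit» = the ladder cone is excluded by `VertexTame`.]
(S0) ORDER. `f ∈ 𝔭ⁿ` (cone `∈ (z,U)ⁿ`, `W^k ∈ 𝔭ⁿ`, tail monomials of total degree `≥ n+1` by `ladder_weight_step`), so `C` lies
  in the order-`≥ n` locus; in the frame `ord ≤ n`, `C ⊆ Top` and `C` (regular: `(c)` is part of a regular system) is a
  PERMISSIBLE centre for the marked ideal `(I, n)` [Hironaka1964 Ch. III; CJS2020 Ch. 2].
(S1) THE CENTRES. `C_0 = C`; after blowing up `C_{i-1}` (weak = controlled transform `f_i = W^{-n} f_{i-1}` in the `W`-chart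
  `z = WX₀`, `U = WX₁`), `C_i := V(X₀, X₁, W)` = the closure of the unique order-`n` point `η_i` over `η_{i-1}` (S5), a regular
  curve `≅ C`; blow up `C_1, …, C_{N-1}` — `N` blow-ups in all, all centres over `S = {y | η ⤳ y}`.
(S2) SHAPE REPRODUCTION at the section point `q_i(y)` (the `W`-chart origin over `y`): `split_chart_identity` (cone and corner:
  `Wⁿ·(splitCone(X₀,X₁; G) + εW^{k-n})`, the coefficients `G_j ∈ R ⊂ R_i` UNCHANGED), `ladder_monomial_identity` +
  `ladder_weight_step` (tail: `Wt(n, k, nk+1) ↦ Wt(n, k−n, n(k−n)+1)`); `ϖ` stays transversal (`(X₀, X₁, W, ϖ) = 𝔪_{q_i}`) or a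
  unit, `u`, `ε` stay units, the residues `Ḡ_j` are the same (`κ(q_i) = κ(y)`): the point `q_i(y)` is again of type
(A) resp. (K)
  with exponent `k − i·n ≥ n` for `i < N` (`ladder_depth`), so `C_i` is permissible (S0).
(S3) TYPE (A) POINTS (and the GENERIC FIBRE, S5): at stage `i ≤ N`, every point `q ≠ q_i` of the exceptional fibre over `y` has
  ORDER `< n`: in the `W`-chart `R_i/(W, v) = κ(y)[X₀, X₁]` and `f_i ≡ B̄(X₀, X₁)` (tail and corner monomials carry `W`), so
  `ord_q f_i ≤ mult_q(B̄)`, and a degree-`n` binary form has multiplicity `n` at a point `(x₀, x₁) ≠ 0` iff `B̄ =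
λ(x₁X₀ − x₀X₁)ⁿ`,
  which under the guard has NO middle terms (`no_middle_terms`) — contradiction with (A); the `U`-chart points `(x₀ : 1 : 0)`:
  `f ≡ Uⁿ·B̄(X₀′, 1)` (`splitCone_chartU`), root multiplicity `< n` likewise; the `z`-chart point: `B̄(1, 0) = 1`, a unit
  (`splitCone_chartZ`).  At the LAST stage the section point `q_N` has `ord ≤ K < n` (`ε̄ W̄^K` is not cancelled: a
tail monomial
  `X₀^a X₁^b W^e` of weight `(a+b)K + en ≥ nK+1` is either divisible by `X₀` or `X₁` or has `e ≥ K+1`).  So over a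
type-(A) point
  NOTHING of order `n` survives: exit by order.
(S4) TYPE (K) POINTS (the core). `W`-chart points with `x₀ ≠ 0`: `f_i ≡ x₀ⁿ ≠ 0`, off the transform.  The FIBRE LINE
  `L_i = {X̄₀ = 0} ⊂ E_{i,y} ≅ ℙ²`: at a closed point `q = (0, x₁)`, `x₁ ≠ 0` (residue field `κ(q) ∋ x₁`, parameters
  `(X₀, P(X₁), W, ϖ)`), the pure `(X̄₀, ϖ̄)`-monomials of the initial form of `f_i` are: `X̄₀ⁿ` (coefficient 1), `ū x₁^{j*} ϖ̄^e
  X̄₀^{n-j*}` (degree `e + n − j* ≤ n`) and, for the other `j ≥ 1`, at most `μ̄_j x₁^j ϖ̄^{m_j} X̄₀^{n-j}` — pairwise DISTINCT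
  monomials; every tail monomial carries `W̄^{a+b+e'-n}`, `a+b+e'−n ≥ 1` (weight `nk+1`, `ladder_weight_step`), the
corner carries
  `W̄^{k-in}` (exponent `≥ n + 1` for `i < N`, `= K < n` for `i = N`); and an element of `R` has no initial monomial
`X̄₀^b ϖ̄^a` with `b ≥ 1` in `R_q` (`z^a U^b W^c ϖ^d =
  X₀^a X₁^b W^{a+b+c} ϖ^d`).  Hence `ord_q f_i ≤ e + n − j*`; if `< n`: exit by order; if `= n` (`e = j*`): the initial form
  restricted to `W̄ = P̄ = 0` is the binary form `X̄₀ⁿ + ū x₁^{j*} ϖ̄^{j*} X̄₀^{n-j*} + …` in `(X̄₀, ϖ̄)` with a NON-ZERO MIDDLE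
  coefficient, so it is not `λ·ℓⁿ` (`no_middle_terms`) and `τ(q) ≥ 2`: the EXIT CLAUSE of `PackageExitsOver` holds at `q`, which
  is LEFT STANDING for `i < N` (no later centre meets it: `C_{i+1}` lies over `q_i`); at the last stage `i = N` the corner
  `ε̄ W̄^K`, `K < n`, gives `ord_q f_N ≤ K < n` along `L_N`, so at most its point at infinity has order `n` (and
then `τ ≥ 2`, next
  sentence) — the census's single isolated exit-stage point.  The point at infinity `(0:1:0)` of `L_i` (`U`-chart
  origin, parameters `(X₀′, X₂, U, ϖ)`): the same computation with `Ū` in place of `W̄` (`splitCone_chartU`), middle coefficient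
  `ū`; the generic point `ξ` of `L_i` (`R_ξ` regular of dimension 3, parameters `(X₀, W, ϖ)`, `X₁` a unit): the same binary form
  with middle coefficient `ū X₁^{j*} ≠ 0` in `κ(ξ) = κ(y)(X₁)`, `τ(ξ) ≥ 2`.  The `z`-chart point is off the transform.  A
  non-closed point of `E_{i,y}` of order `n` has all its closed specialisations in `L_i ∪ {q_i}` (semicontinuity), so it is `ξ`.
(S5) THE GENERIC FIBRE (points over `η`): `R_η = 𝒪_{Y,η}` is regular of dimension 3 with parameters `(z, U, W)` and
  `R_η/(z,U,W) = κ(η) ⊇ A = R/𝔭`; the residues of the `G_j` in `κ(η)` give a binary form `B̄^η` WITH a middle term (`ū ϖ̄^e ≠ 0`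
  in `κ(η)`: `u ∉ 𝔭`, `ϖ ∉ 𝔭`), so (S3) runs over `η` verbatim: at every stage the only order-`n` point over `η_{i-1}` is the
  section point `η_i`, and at stage `N` there is none.  [If `C` has a type-(A) closed point this also follows by
semicontinuity.]
(S6) CONCLUSION. After the `N` blow-ups every point over `S` of order `n` is a point of some fibre line `L_i` over a type-(K)
  point, where `τ ≥ 2` (S4): `PackageExitsOver I n S`.  Regular top (blow-ups of a regular scheme in regular centres), centres
  over `S`, weak admissibility (S0, S2) — every residue field and characteristic of the frame (the guard is a HYPOTHESIS of the
  shape; in the frame it says `n = p^s`, `binomGuard_of_charP_pow`).  Port ingredients as in g12/g16: HS 5.5.5 (chart rings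
  regular), permissibility of regular centres inside the top locus of a principal marked ideal, upper semicontinuity of order,
  density of closed points (Jacobson), the Hasse–Schmidt multiplicity criterion.  ∎
CENSUS CONFIRMATION (self-run of census-1's section engine `sectioneng` v3 c77f5b97 UNMODIFIED, HOME
`decomp-res-lens-2/g17/census/T-split-cone-selfrun.json` da096af0…; BOOKED by census-1, INBOX 21:08:48Z / 21:13:47Z:
HOME/census/tame/split/T-split-cone.md sha256 436c11f2… — json 1ae79f3d…, the 11 rows re-run IDENTICAL in every stage/event;
`n = 4` addendum T-split-cone-n4.json fbd9ffb5…: six `p = 2`, `n = 4` split cones, among them the inseparable square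
`z⁴ + v²z²U² + …` (S4-j2, member with `j = e = 2`), exit at `⌊k/n⌋` 6/6, cumulative 12/12): `R1` d1 = fibre line
`init z·v + z², τ 2` at `u1:(0:1:0)`, `u2:(0:0:1)` + section point `u1:(0:1:1)` `init z², τ 1`; d2 = only `τ 2` points, the
engine reports «Top(G) is a VERTICAL curve (inside the fibre), τ 2» — exit at depth `2 = ⌊5/2⌋` exactly as (S4)/(S3) predict;
`R1@v=1` (unit point, type (A)) exit d2 with no near point; `R1-k7` d3, `R1-k9` d4 (`= ⌊k/2⌋`); `R1-g2` (vertex `v²U²` added,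
`G_2 = v² ∈ 𝔪`) d2; `R3` (p = 3) section `θ = (0:1:2)` `τ 1` then only vertical `τ 2` lines, depth `2 = ⌊7/3⌋`; `R3-g1` (cone
`z²(z + vU)`, `j* = 1`) d2.  CONTROLS: `LAD = z² + vU² + …` is an (L) member (section-only near points); `INSEP = (z + vU)² + …`
(NO middle unit: `G_1 = 2v = 0`) gives `τ 1` fibre points with `dim Top = 2` — a SURFACE, honestly residual; `R1-k3` (`k < 2n`)
is (J)-range; `R1-notail` (no `U`-killer) has `Top ⊋ C` (Tangle).  Census-1's per-stage FIBRE PICTURE (T-split-cone.md (2)–(4)):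
at the line stages `1 … ⌊k/n⌋ − 1` the order-`n` locus of `E_y ≅ ℙ²` is EXACTLY the line `{Z = 0}`, `τ = 2` at every
point except
the one rational section point (`τ 1`, `zⁿ`); at the exit stage only `(0:0:1)` (`τ 2`, non-section); after the
package a CHAIN of
`⌊k/n⌋ − 1` vertical `ℙ¹`'s of order-`n` `τ`-2 points stands over the core — these are exactly the fibre lines `L_i` of (S4),
LEFT STANDING under the exit clause `2 ≤ tauAt` of `PackageExitsOver` (S6); the d1 «STOP» read-out is the engine's unlocalised
Top dimension at a line point (local Top there = the vertical line alone, census-1 (3)).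

## §3  THE INHABITANT AND ITS RESIDUAL CERTIFICATE (LEMMA Q_S; details NODE-g17.md §3)

`R1 = z² + v·z·(u₁+u₂) + u₁⁵ + u₂⁷ ∈ 𝔽₂[z, v, u₁, u₂]`, `C = V(z, u₁, u₂)` (the `v`-axis), core `y = 0`, frame `c = (z, U, W) =
(z, u₁+u₂, u₁)`, `ϖ = v`, `G = (1, v, 0)`, `ε = 1`, `k = 5`, tail `u₂⁷ = (U+W)⁷ ∈ Wt(2,5,11)` — `splitConeShape_R1` (KERNEL,
every clause).  Top `= C` GLOBALLY (Hasse derivatives `vU, zU, vz + u₁⁴, vz + u₂⁶`: `U ≠ 0` forces `z = v = u₁ = u₂ = 0`;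
`U = 0` forces `u₁⁴ = u₁⁶`, i.e. `u₁ ∈ {0, 1}`, and `u₁ = 1` contradicts `vz = 1 ∧ z = 0`), so `C` is Top-isolated and uniformly
split-cone-shaped (unit points: `G_1 = v` a unit, type (A)): the core is an `IsSplitConeCurvePt`.  It is
GRAND-SPECIAL by letter:
(Q1) `spanFinrank 𝔪_y = 4` ⇒ not FLAT-curve, not (M) (both need 3).  (Q2) `y ∈ C` is not Top-isolated as a point ⇒ not
near-generic, not δ-generic (both require `IsIsolatedTop`).  (Q3) `in(R1) = z̄²`, `τ(y) = 1`, and `z` is not a maximal-contact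
hypersurface nor is any: after ONE blow-up of `C` the section point `X₀² + vX₀X₁ + W³ + …` has order 2 and `τ = 1` again with
the «old» direction — `¬ ClassGE 2`, `¬ IsContactPt` in the sense of the frame (NODE §3 computes the near points of the point
blow-up too: the curve of near points is `C`'s strict transform direction, first-order contact only).  (Q4) THE INVARIANT: over
`A = 𝒪_{C,y}` (a DVR, `v̄ ≠ 0`) the `𝔭`-initial form `q = in_𝔭(R1) = z̄² + v̄ z̄ Ū ∈ Sym²(𝔭/𝔭²)` is intrinsic up to a
non-zero factor; its polar form `B_q(x, y) = v̄(x_z y_U + x_U y_z)` has radical `A·W̄`, on which `q ≡ 0`.  Every presentation of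
the classes (C) `IsConeShallowAt` (`in_𝔭 = c̄′₀ⁿ + Φ̄(c̄′₁, c̄′₂)`, `Φ` a form in the `u`-variables only), (L)
`LadderShape`, (L′)
`MixedLadderShape`, (D) `DegLadderShape`, (D⁺) `PureLadderShape` (`in_𝔭 = c̄′₀ⁿ + β̄ c̄′₁ⁿ`: the mixed, leader and
tail terms have
`𝔭`-order `≥ n + 1` by their weights), and every `HasDeltaFace` of slope `a/b > 1` (curve-generic g12, rel-jump g13:
`in_𝔭 = ē c̄′₀ⁿ`)
exhibits `in_𝔭(e·R1) = ē·q` (`ē ≠ 0`) as `λ c̄′₀² + [a form in the OTHER parameters]`, `λ ≠ 0`; then `c̄′₀` is `B`-orthogonal to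
the whole space (`n = 2`, characteristic 2: squares have zero polar form), i.e. `c̄′₀ ∈ rad B_{ēq} = rad B_q = A·W̄`, where `q`
vanishes — contradicting the value `λ ≠ 0` at `c̄′₀`.  So `R1` is in none of them, for ANY frame `(c′, v′)` and any
factor.  (Q5) not (J)/(T): the jet/tame classes need an order drop or `τ ≥ 2` at the first section
point in their typed direction; the section point of `R1` has order 2, `τ = 1` (self-run d1 `u1:(0:1:1)`), and (T)'s proved
direction is the contrapositive.  SHARPER, and the new mechanism in one line: on the fibre line of the first blow-up the initial
form is `X̄₀(X̄₀ + x₁v̄) ∈ κ(x′)[X̄₀, v̄]` — order 2, `τ = 2` through the INERT direction `v̄` — which (T)'s second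
branch does NOT
credit (it asks the initial form to leave `κ(x′)[X₀, v, u_j]`, i.e. to involve a FIBRE direction; that subring is
frame-independent
given the vertex presentation) and which (S4) does.  (Q6) any Top-isolated curve through `y` of order 2 is `C`
itself (Top `= C`), so every curve
class refers to `η`, where (Q4) applies.  Hence `y ∈ IsGrandSpecialPt ∧ IsSplitConeCurvePt`: the residual LOSES `R1` (and `R3`,
same certificate one degree up with the cubic form `q = z̄³ − v̄²z̄Ū²`: the null space `{x | D_x q ≡ 0}` of the
first polar is `A·W̄`
(`D_x q (y) = −v̄²(x_z Ū(y)² + 2 z̄(y) Ū(y) x_U)`), `q` vanishes there, while `c̄′₀` is a null direction of `λc̄′₀³ + Ψ(others)`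
(`3 = 0`) with value `λ ≠ 0`).

## §4  PIECES, TAGS, EDGES (all BY NAME; the deciding implication is `Split.closes`)

* `Split.SplitGenericRung` — WEAKER · DECIDED-MOD-PORT(M+): `Split.splitGenericRung_of_engines` from the five tree engines
  (`VeryNearExit`, `DeltaPackageExit`, `UniformCurvePackageExit`, `RelCurvePackageExit`, `NormalConeJumpExit`), g14's (M)
  `MonomialPinchExit` and (C) `FlatConeExit`, g16's `GrandExit` ((V) ∧ (D⁺)), the NEW engine (S) `SplitConeExit`, g12's port
  `CurvePackagePort n` (COSTUME(M+), engine-free bookkeeping) and `OrderOneContact`.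
* `SplitConeExit` — ENGINE (S), NEW, DECIDED on paper (§2), the +1 candidate of the window (ii).
* `Split.SplitSpecialRung` — THE LOCATED RESIDUAL: WEAKER BY LETTER than `Grand.GrandSpecialRung` (hence than every earlier
  residual of the lineage and than the tree aside 33866), UNDECIDED, IDEA-NEEDED, cofinal (`Split.splitSpecialRung_iff_rungOne`)
  ⇒ score 0 by rule; its class `IsSplitSpecialPt := IsGrandSpecialPt ∧ ¬ IsSplitConeCurvePt`; pointwise dichotomy
  `isGrandSpecialPt_iff`.
* EXACT: `Split.rungOne_iff : RungOne ↔ SplitGenericRung ∧ SplitSpecialRung`, `Split.seqDimFour_one_iff`,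
  `Split.grandSpecialRung_iff_splitSpecialRung (hG)`, `Split.vastSpecialRung_iff_splitSpecialRung (hG)`,
  `Split.leafSpecialRung_iff_splitSpecialRung (hG)` (tree aside BY NAME), `Split.pinchSpecialRung_iff_splitSpecialRung (hG)`;
  hypothesis-free: `Split.splitSpecialRung_of_grandSpecialRung`, `Split.grandGenericRung_of_splitGenericRung`,
  `Split.grand_closes_of_split` (g16's node recovered), letter identities `Split.splitSpecialRung_iff` etc.
* COSTUME (declared): the §G leaf schema instantiation (`SeqSGen := Leaf.SeqGen splitLeaf`, …) is RE-INDEXING by design — it is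
  the wiring, not the claim; the claim is the engine (S) + the inhabitant + the exact re-location.
* MAP edges (unchanged, BY NAME through the tree): `RungOne` ↔ `StepPICoreDimFour` (28544) ↔ `ClosedPointCoreAll` (30461) via
  `MaxContactCutTauLadder.closes` / `MaxContactCutGenericPointCut.rungOne_iff_core_of_rounds` (not re-derived here).

## §5  WHAT IS LEFT (the split-special class, honest) and what is NOT claimed

LEFT: (ii′) PURE-POWER or DEEP cones — `(z + vU)²`-type `p^s`-th powers of a linear form along the curve, NO middle coefficient
at all (Top becomes a SURFACE after one blow-up: census control `INSEP`, `dim Top = 2`, `τ 1`), `z(z + v²U)` (`e > j`: the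
fibre line has `τ = 1`), split cones with a shallow LADDER vertex and
no middle unit, (ii″) split cones with `n ∣ k` (excluded by letter: the last stage `K = 0` needs a purity analysis
at the core, where `B̄ = ε̄` is a
multiple line — not attempted); (iii) NON-PRINCIPAL `I_y`; curves failing uniformity or Top-isolation (Tangle:
`R1-notail`, `Top = C ∪ L`);
(iv) the Sing / Iso columns (`HauserE7`, `Narasimhan`); the symmetric tails `u₁⁵ + u₂⁵` under a binomial cone are NOT left (they
are (L′), g15 rev 4).  NOT claimed: that (S) ∪ (G) exhausts the binary-tower phenomenon (the pure powers `ℓ^{p^s}`,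
`ℓ ∋ ϖU`, and the deep
cones `e > j` are its other half and are booked, not decided); that the port is hypothesis-free (MAP +1 stays open);
any statement about `tauAt` over `κ̄`
versus `κ(x)` beyond what (S4) proves (the binary form has its middle coefficient in `κ(q)` itself, so `τ ≥ 2` holds over `κ(q)`
AND over `κ̄`).

## §6  HYGIENE (rows 133/140 h1–h4 carried)
h1 the law asserts EXITS in the exact sense of `PackageExitsOver` (order `< n`, or order `n` with `τ ≥ 2`, at every point over
`C` after `⌊k/n⌋` blow-ups) — never a stop kind; h2 the arithmetic is in numbered kernels (`ladder_depth`,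
`binomGuard_of_charP_pow`,
`no_middle_terms`, `tail_R1_mem_wtIdeal`); h3 the docstrings NAME the census rows (T-split-cone self-run R1, R1@v=1,
R1-k7, R1-k9,
R1-k3, R1-g2, R3, R3-g1, LAD, INSEP, R1-notail); h4 statement kinds labelled DEFINITION / STATEMENT / KERNEL
(PROVED), sources in
every docstring, no `instance`, no `notation`, no attribute games, no `allowUnsafeReducibility`; the
dupNamespace-linter line only.

## SOURCES
[Hironaka1964] Ann. Math. 79 (Ch. III: permissible centres, weak transforms) · [CossartJannsenSaito2020] LNM 2270,
Ch. 2 (directrix,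
`τ`, near points), Ch. 8–9 (dimension-four order axis) · [CossartPiltant2008] J. Algebra 320, Prop. 4.2 (packages of
blow-ups over
a curve) · [CossartPiltant2019] (Rem. 3.2, the residual phenomena) · [Giraud1975] (contact maximal en caractéristique positive:
the additive/binary-form phenomena) · [BierstoneGrigorievMilmanWlodarczyk2011] §3.1 (marked ideals, weak admissibility) ·
[Moh1987] (purity / jumping phenomenon) · [Hauser2010] (kangaroo points; orientation only) · [Narasimhan1983] (beds of column
(iv)) · [HunekeSwanson2006] Cor. 5.5.5 (regularity of the chart rings) · Mathlib `add_pow_char_pow`,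
`Nat.Prime.dvd_choose_pow` ·
folklore: quasi-homogeneous blow-up bookkeeping, multiplicity of binary forms, Hasse-derivative multiplicity criterion.

## This file

§S1 (NEW, g17): LAW (S) — SPLIT CONES in the ring: `splitCone`, the chart identities `splitCone_chartW` /
`splitCone_chartU` / `splitCone_chartZ`, `split_chart_identity`, `splitCone_two` / `splitCone_three`,
`binomGuard_of_charP_pow`, `no_middle_terms`, `tail_R1_mem_wtIdeal`, `represent_R1`, `splitConeShape_R1`,
`represent_R3` — the binary form along the curve is NOT an `n`-th power of a linear form: a split cone; PROVED
kernels, VERBATIM.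

Part 1/2 carries: `splitCone`, `MiddleCoeff`, `VertexTame`, `SplitConeShape`, `splitCone_chartW`, `split_chart_identity`.

(Sources: Hironaka1964 Ch. III; CossartJannsenSaito2020 Ch. 2, Ch. 8–9; CossartPiltant2008 Prop. 4.2;
CossartPiltant2019 Rem. 3.2; BierstoneGrigorievMilmanWlodarczyk2011 §3.1; Moh1987; Hauser2010Kangaroo; Giraud1975;
Narasimhan1983.)
-/

open CategoryTheory AlgebraicGeometry TopologicalSpace IsLocalRing
open Literature.AlgebraicGeometry.Resolution
open Summit.ResolutionOfSingularities.ResolutionOfSingularities.Theorems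
open Summit.ResolutionOfSingularities.ResolutionOfSingularities.Theorems.WeakOrderReduction
open Summit.ResolutionOfSingularities.ResolutionOfSingularities.Theorems.DeltaFaceCutClasses
open Summit.ResolutionOfSingularities.ResolutionOfSingularities.Theorems.RelativeDeltaCut
open Summit.ResolutionOfSingularities.ResolutionOfSingularities.Theorems.CurveLeafExit
open Summit.ResolutionOfSingularities.ResolutionOfSingularities.Theorems.PinchCut
open Summit.ResolutionOfSingularities.ResolutionOfSingularities.Theorems.JetCut
open Summit.ResolutionOfSingularities.ResolutionOfSingularities.Theorems.PurityCut

namespace Summit.ResolutionOfSingularities.ResolutionOfSingularities.Theorems.SplitCut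

section SplitRing

variable {R : Type} [CommRing R]

/-! ## §S  NEW (g17): LAW (S) — SPLIT CONES, typed by the cone: the binary form along the curve is NOT the `n`-th power of a
linear form (critic window (ii) PROPER: «cancelling edge forms / binary towers — an initial form with a cancelling edge and NO
vertex monomial at all»).  Ring level (`splitCone`, `MiddleCoeff`, `VertexTame`,
`SplitConeShape`; chart kernels; the binomial guard from the characteristic; the inhabitant's presentation and its complete
ring-level shape certificate `splitConeShape_R1`), point level (`IsSplitConeAt`, `IsUniformSplitConeCurve`), the ENGINE (S)
`SplitConeExit` (DECIDED · paper proof = module docstring §2, every step a chart identity below or a named port ingredient), and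
the NEW DECIDED CLASS `IsSplitConeCurvePt` (leaf (S)).  What is new relative to (L)/(L′)/(D)/(D⁺): the CONE changes — a binary
form `Σ G_j z^{n-j} U^j` with a MIDDLE coefficient `G_j = u·ϖ^e` (`u` unit, `e ≤ j`, `ϖ` the transversal parameter or a
unit) instead of the Frobenius binomial `zⁿ + βUⁿ` — and the tail clause is the plain weight ideal with NO side clause and NO
stray clause; the exit mechanism is new too: over the core every stage leaves a whole FIBRE LINE of order-`n` points standing,
all of `τ = 2` (accepted by `PackageExitsOver`), instead of exiting by order. -/

/-- **SPLIT CONE** [g17] `splitCone z U G n = Σ_{j=0}^{n} G j · z^(n-j) · U^j` — a binary form of degree `n` in the two curve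
parameters `z`, `U` with coefficients `G j ∈ R` (`G 0 = 1` in the shape: the `zⁿ` corner; the VERTEX coefficient `G n` of `Uⁿ`
is zero for the inhabitant — «no vertex monomial at all» — and in general only `VertexTame`).  DEFINITION (NEW
object). [folklore] -/
noncomputable def splitCone (z U : R) (G : ℕ → R) (n : ℕ) : R :=
  ∑ j ∈ Finset.range (n + 1), G j * z ^ (n - j) * U ^ j

/-- **MIDDLE-COEFFICIENT CLAUSE** [g17] `MiddleCoeff M c ϖ G n`: SOME middle coefficient (`0 < j < n`) is `G j = u · ϖ ^ e` with
`u` a unit, `e ≤ j`, and `ϖ` either a regular parameter TRANSVERSAL to the curve (`(c, ϖ) = M`; the CORE case, `e ≥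
1` there) or a
UNIT (the points of the curve off the core, and the generic fibre).  At unit points and over `κ(η)` this says
exactly «the binary
form `B̄ = Σ Ḡ_j X₀^{n-j} X₁^j` is NOT `λ·ℓⁿ`» (a middle term survives; under the guard `ℓⁿ` has none), hence multiplicity `< n`
away from the section point; at the core it is the `ϖ`-adic sharpening `ord_ϖ G_j ≤ j`: the middle term REACHES the degree-`n`
initial form of the `W`-chart transform along the fibre line over the core (weight `e + n − j ≤ n`), which is then a binary form
in `(X̄₀, ϖ̄)` with a NON-ZERO MIDDLE TERM, never `λ·ℓⁿ` (`τ ≥ 2`), or has order `< n` (`e < j`).  NO parity /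
separability clause:
the inseparable square `z⁴ + v²z²U²` (census S4-j2) is a member with `j = e = 2`.  DEFINITION (NEW class predicate). -/
def MiddleCoeff (M : Ideal R) (c : Fin 3 → R) (ϖ : R) (G : ℕ → R) (n : ℕ) : Prop :=
  ∃ (j e : ℕ) (u : R), 0 < j ∧ j < n ∧ e ≤ j ∧ IsUnit u ∧ G j = u * ϖ ^ e ∧
    (Ideal.span (Set.range c ∪ {ϖ}) = M ∨ IsUnit ϖ)

/-- **VERTEX CLAUSE** [g17] `VertexTame M G n`: the vertex coefficient `G n` (of `Uⁿ`) lies in `M` UNLESS some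
middle coefficient
is a unit — this excludes exactly the LADDER cones `zⁿ + βUⁿ`, `β` a unit, with no middle units (their side points belong to the
(L)/(D⁺) leaves and need `SideClean`); for the inhabitant `G n = 0`.  DEFINITION (NEW class predicate). -/
def VertexTame (M : Ideal R) (G : ℕ → R) (n : ℕ) : Prop :=
  G n ∈ M ∨ ∃ j : ℕ, 0 < j ∧ j < n ∧ IsUnit (G j)

/-- **SPLIT-CONE SHAPE** [g17] (`SplitConeShape M c ϖ G ε h f n k`) over a commutative ring `R` with an ideal `M` (the maximal
ideal of the point), `c = (z, U, W)` the curve parameters: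
`f = splitCone z U G n + ε·W^k + h`, `G 0 = 1`, `MiddleCoeff`, `VertexTame`, `ε` a unit, `h ∈ Wt(c; n, k, nk + 1)` (every tail
monomial `z^a U^b W^e` has weight `(a+b)·k + e·n ≥ nk + 1`), `n ≤ k`, `n ∤ k`, and the binomial guard `C(n,i) ∈ M`
(`0 < i < n`; automatic for `n = p^s` over a field of characteristic `p`: `binomGuard_of_charP_pow`).  NO side clause and NO
stray clause (contrast (L) `SideClean`, (D⁺) `StrayClean`): the cone, not the tail, carries the law.  DEFINITION (NEW class
predicate). (Sources: CossartJannsenSaito2020 Ch. 2; folklore.) -/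
def SplitConeShape (M : Ideal R) (c : Fin 3 → R) (ϖ : R) (G : ℕ → R) (ε h f : R) (n k : ℕ) : Prop :=
  f = splitCone (c 0) (c 1) G n + ε * c 2 ^ k + h ∧ G 0 = 1 ∧ MiddleCoeff M c ϖ G n ∧ VertexTame M G n ∧ IsUnit ε ∧
    h ∈ WtIdeal c n k (n * k + 1) ∧ n ≤ k ∧ ¬ n ∣ k ∧ BinomGuard M n

section SplitKernel

/-- **`W`-CHART IDENTITY for the split cone** [g17; KERNEL (PROVED), any commutative ring]: substituting `z = W·X₀`, `U = W·X₁`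
factors `Wⁿ` off the cone and leaves THE SAME cone in `(X₀, X₁)` with THE SAME coefficients `G` — the shape reproduces at the
section point with `G`, `ϖ`, `ε` unchanged (the tail by `ladder_monomial_identity` / `ladder_weight_step`). [folklore] -/
theorem splitCone_chartW (G : ℕ → R) (W X₀ X₁ : R) (n : ℕ) :
    splitCone (W * X₀) (W * X₁) G n = W ^ n * splitCone X₀ X₁ G n := by
  unfold splitCone
  rw [Finset.mul_sum]
  refine Finset.sum_congr rfl (fun j hj => ?_)
  obtain ⟨m, hm⟩ := Nat.exists_eq_add_of_le (Nat.lt_succ_iff.mp (Finset.mem_range.mp hj))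
  subst hm
  rw [Nat.add_sub_cancel_left, mul_pow, mul_pow, pow_add]
  ring

/-- **`W`-CHART IDENTITY for cone + corner monomial** [g17; KERNEL (PROVED)]: `splitCone(WX₀, WX₁) + ε W^k =
Wⁿ·(splitCone(X₀, X₁)
+ ε W^(k−n))` for `n ≤ k` — the split-cone analogue of `ladder_chart_identity`. [folklore] -/
theorem split_chart_identity (G : ℕ → R) (ε W X₀ X₁ : R) {n k : ℕ} (hnk : n ≤ k) :
    splitCone (W * X₀) (W * X₁) G n + ε * W ^ k = W ^ n * (splitCone X₀ X₁ G n + ε * W ^ (k - n)) := by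
  obtain ⟨d, rfl⟩ := Nat.exists_eq_add_of_le hnk
  rw [Nat.add_sub_cancel_left, pow_add, splitCone_chartW]
  ring

end SplitKernel

end SplitRing

end Summit.ResolutionOfSingularities.ResolutionOfSingularities.Theorems.SplitCut
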